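import Summits.QuantumFields.YangMills.Theorems.PoincareLipschitzSobolevCellAverages
import Summits.QuantumFields.YangMills.Theorems.PoincareLipschitzSamplingCells
import HarnessLib

/-!
# Crux `HistoryTailL` (stmt-QuantumFields-19936), road R1 (LINE 25 `CompactnessTransfer`, S2♭″ brick (Γ5-C), part 1) — «BAD CELLS ARE FEW»:
# for a unit-sphere-valued Sobolev map `V` on the open unit cube and its cell averages `a y = R³∫_{cell_y} V`, the oscillation
# `osc_y := 1 − ‖a y‖²` EQUALS `R³∫_{cell_y}‖V − a y‖²` and is `≤ C_P²·R·∫_{cell_y}‖GV‖²`; hence the number of BAD cells (`‖a y‖² < 1 − κ`) among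
# any family of cells inside the cube is `≤ C_P²·R·∫_Q‖GV‖² ∕ κ` — `O(R)` out of `O(R³)`

Cell `ym3-torus` (YM ladder rung R3 = continuum SU(2) Yang–Mills on T³ — a RUNG, NOT the Clay problem: not d = 4, not infinite volume, not a mass
gap); TWIN-WIDTH helper seat `ym-ust-19936-w7` g13 (LEAD ★w1-19936 g10 12:29:32Z S2♭″ architecture; Γ5 pens of record 13:02Z: (Γ5-C) = w7).
Helper `--supports stmt-QuantumFields-19936`; THEOREMS ONLY (0 `def`, 0 `sorry`, default heartbeats).  Imports ✓px15 g6 (Γ5a) FILE D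
`…SobolevCellTiling` (hence FILE B: cell Poincaré–Wirtinger `exists_eLpNorm_sq_sub_smul_setIntegral_cell_le`, `volume_cell`, `isOpen_cell`; D's
`eLpNorm_two_sq`) and ✓w7 `…SamplingCells` (`disjoint_cell`, `measurableSet_cell`).  Cells are the OPEN cells `Π (yᵢ∕R, (yᵢ+1)∕R)`.

WHAT IS PROVED (ns `…Theorems.PoincareLipschitzSobolevBadCellCount`).
* §1 `integral_norm_sq_eq_toReal_lintegral`, ★`one_sub_norm_sq_eq_integral` (the Hilbert identity
  `1 − ‖a‖² = R³·∫_{cell}‖V − a‖²` for `‖V‖ = 1` on the cell, `a = R³∫_{cell}V`).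
* §2 ★★`osc_le_lintegral_cell` (`ofReal (1 − ‖a y‖²) ≤ C_P²·R·∫⁻_{cell_y}‖GV‖ₑ²` for a cell inside the unit cube), ★★★`card_bad_mul_le`
  (`ofReal κ · #{y ∈ Y | ‖a y‖² < 1 − κ} ≤ C_P²·R·∫⁻_Q‖GV‖ₑ²` for any finset `Y` of sites whose cells lie in `Q`).
* §3 `enorm_sq_le_dens` (`‖L‖ₑ² ≤ Σᵢ ‖L eᵢ‖ₑ²`), `lintegral_opNorm_sq_lt_top` (`∫⁻_Q ‖GV‖ₑ² < ∞` when every `GV·v ∈ L²(Q)`).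
HONEST SCOPE.  One counting brick of S2♭″'s (Γ5); S2♭″, S1″-band, `hHalvingBand`, K1, `MeanDeviationL`, `BlockLipschitzL`, `HistoryTailL` are NOT proved here.
YM₃ on T³ is rung R3, not Clay; YM gap NOT proved; no summit statement is proved here.

References: L. C. Evans, Partial Differential Equations (2010) §5.8.1 (Poincaré–Wirtinger); R. Hardt, D. Kinderlehrer, F.-H. Lin, Comm. Math. Phys. 105
(1986) 547–570 [HardtKinderlehrerLin1986] (bad-set counting in the projection argument).
-/

set_option autoImplicit false

noncomputable section

open MeasureTheory Set Finset
open scoped BigOperators InnerProductSpace NNReal ENNReal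

namespace Summit.QuantumFields.YangMills.Theorems.PoincareLipschitzSobolevBadCellCount

open RealInnerProductSpace
open Literature.Analysis.FunctionSpaces
open Literature.MathematicalPhysics.QuantumFieldTheory.Balaban1983to89
open B4Eq19LatticeOperators (Zd)
open Summit.QuantumFields.YangMills.Theorems.PoincareLipschitzSobolevCellAverages
  (isOpen_cell volume_cell exists_eLpNorm_sq_sub_smul_setIntegral_cell_le)
open Summit.QuantumFields.YangMills.Theorems.PoincareLipschitzSamplingCells (disjoint_cell measurableSet_cell)

/-! ## §1 `L²` bookkeeping and the Hilbert identity on a cell -/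

/-- `‖f‖²_{L²(ν)} = ∫⁻ ‖f‖ₑ²` (private copy of px15 D's `eLpNorm_two_pow_two`, kept private so that this file does not wait on D's olean
and does not duplicate a public name). [folklore] -/
private theorem eLpNorm_two_sq {X : Type*} [MeasurableSpace X] {ν : Measure X} {G : Type*} [NormedAddCommGroup G]
    (f : X → G) : eLpNorm f 2 ν ^ 2 = ∫⁻ x, ‖f x‖ₑ ^ 2 ∂ν := by
  rw [eLpNorm_eq_lintegral_rpow_enorm_toReal two_ne_zero ENNReal.ofNat_ne_top, ENNReal.toReal_ofNat]
  simp only [ENNReal.rpow_ofNat, one_div]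
  rw [← ENNReal.rpow_natCast ((∫⁻ x, ‖f x‖ₑ ^ 2 ∂ν) ^ (2 : ℝ)⁻¹), ← ENNReal.rpow_mul]
  norm_num

/-- For an a.e.-strongly measurable `f` with `∫⁻_S ‖f‖ₑ² < ∞`: `∫_S ‖f‖² = (∫⁻_S ‖f‖ₑ²).toReal`. [folklore] -/
theorem integral_norm_sq_eq_toReal_lintegral {X : Type*} [MeasurableSpace X] {ν : Measure X} {G : Type*} [NormedAddCommGroup G]
    (f : X → G) (hf : AEStronglyMeasurable f ν) :
    ∫ x, ‖f x‖ ^ 2 ∂ν = (∫⁻ x, ‖f x‖ₑ ^ 2 ∂ν).toReal := by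
  rw [integral_eq_lintegral_of_nonneg_ae (Filter.Eventually.of_forall fun x => by positivity)
    (hf.norm.aemeasurable.pow_const 2).aestronglyMeasurable]
  congr 1
  refine lintegral_congr fun x => ?_
  rw [← ofReal_norm, ENNReal.ofReal_pow (norm_nonneg _)]

/-- ★ THE HILBERT IDENTITY ON A CELL.  If `‖V‖ = 1` on a measurable set `S` of finite real volume `vol > 0`, `V` is integrable on `S`, and
`a = vol⁻¹ • ∫_S V`, then `∫_S ‖V − a‖² = vol·(1 − ‖a‖²)`. [folklore] -/
theorem integral_norm_sub_avg_sq_eq {S : Set (EuclideanSpace ℝ (Fin 3))} (hS : MeasurableSet S)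
    (hvol : volume S ≠ ∞) (V : EuclideanSpace ℝ (Fin 3) → EuclideanSpace ℝ (Fin 4)) (hVint : IntegrableOn V S volume)
    (hV1 : ∀ x ∈ S, ‖V x‖ = 1) (a : EuclideanSpace ℝ (Fin 4)) (ha : (volume S).toReal • a = ∫ x in S, V x) :
    ∫ x in S, ‖V x - a‖ ^ 2 = (volume S).toReal * (1 - ‖a‖ ^ 2) := by
  have hconst : IntegrableOn (fun _ : EuclideanSpace ℝ (Fin 3) => (1 : ℝ)) S volume := integrableOn_const hvol
  have hinner : IntegrableOn (fun x => ⟪a, V x⟫) S volume := hVint.const_inner a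
  have hpt : ∀ x ∈ S, ‖V x - a‖ ^ 2 = 1 - 2 * ⟪a, V x⟫ + ‖a‖ ^ 2 := by
    intro x hx
    rw [norm_sub_sq_real, hV1 x hx, real_inner_comm]
    ring
  rw [setIntegral_congr_fun hS hpt]
  have h1 : ∫ x in S, (1 - 2 * ⟪a, V x⟫ + ‖a‖ ^ 2) =
      (∫ x in S, (1 : ℝ)) - 2 * (∫ x in S, ⟪a, V x⟫) + ∫ x in S, ‖a‖ ^ 2 := by
    have h12 : Integrable (fun x => (1 : ℝ) - 2 * ⟪a, V x⟫) (volume.restrict S) := hconst.sub' (hinner.const_mul 2)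
    have h3 : Integrable (fun _ : EuclideanSpace ℝ (Fin 3) => ‖a‖ ^ 2) (volume.restrict S) := integrableOn_const hvol
    rw [integral_add h12 h3, integral_sub hconst (hinner.const_mul 2), integral_const_mul]
  have hI : ∫ x in S, ⟪a, V x⟫ = ⟪a, ∫ x in S, V x⟫ := integral_inner (𝕜 := ℝ) hVint a
  rw [h1, hI, ← ha, setIntegral_const, setIntegral_const, smul_eq_mul, smul_eq_mul, mul_one,
    real_inner_smul_right, real_inner_self_eq_norm_sq, Measure.real]
  ring

/-- ★ On the open grid cell `cell_y = Π(yᵢ∕R,(yᵢ+1)∕R)` (volume `R⁻³`): with `a = R³ • ∫_{cell}V` and `‖V‖ = 1` on the cell,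
`1 − ‖a‖² = R³·∫_{cell}‖V − a‖²`. [folklore] -/
theorem one_sub_norm_sq_eq_integral {R : ℕ} (hR : 0 < R) (y : Zd 3)
    (V : EuclideanSpace ℝ (Fin 3) → EuclideanSpace ℝ (Fin 4))
    (hVint : IntegrableOn V {x : EuclideanSpace ℝ (Fin 3) | ∀ i, (y i : ℝ) / R < x i ∧ x i < ((y i : ℝ) + 1) / R} volume)
    (hV1 : ∀ x ∈ {x : EuclideanSpace ℝ (Fin 3) | ∀ i, (y i : ℝ) / R < x i ∧ x i < ((y i : ℝ) + 1) / R}, ‖V x‖ = 1)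
    (a : EuclideanSpace ℝ (Fin 4))
    (ha : a = ((R : ℝ) ^ 3) • ∫ x in {x : EuclideanSpace ℝ (Fin 3) | ∀ i, (y i : ℝ) / R < x i ∧ x i < ((y i : ℝ) + 1) / R}, V x) :
    1 - ‖a‖ ^ 2 = (R : ℝ) ^ 3 * ∫ x in {x : EuclideanSpace ℝ (Fin 3) | ∀ i, (y i : ℝ) / R < x i ∧ x i < ((y i : ℝ) + 1) / R},
      ‖V x - a‖ ^ 2 := by
  have hR0 : (0 : ℝ) < R := by exact_mod_cast hR
  have hvolE := volume_cell hR y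
  have hvol : volume {x : EuclideanSpace ℝ (Fin 3) | ∀ i, (y i : ℝ) / R < x i ∧ x i < ((y i : ℝ) + 1) / R} ≠ ∞ := by
    rw [hvolE]; exact ENNReal.ofReal_ne_top
  have hvolR : (volume {x : EuclideanSpace ℝ (Fin 3) | ∀ i, (y i : ℝ) / R < x i ∧ x i < ((y i : ℝ) + 1) / R}).toReal
      = ((R : ℝ)⁻¹) ^ 3 := by
    rw [hvolE, ENNReal.toReal_ofReal (by positivity)]
  have hRR : ((R : ℝ)⁻¹) ^ 3 * (R : ℝ) ^ 3 = 1 := by field_simp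
  have ha' : (volume {x : EuclideanSpace ℝ (Fin 3) | ∀ i, (y i : ℝ) / R < x i ∧ x i < ((y i : ℝ) + 1) / R}).toReal • a =
      ∫ x in {x : EuclideanSpace ℝ (Fin 3) | ∀ i, (y i : ℝ) / R < x i ∧ x i < ((y i : ℝ) + 1) / R}, V x := by
    rw [hvolR, ha, smul_smul, hRR, one_smul]
  have h := integral_norm_sub_avg_sq_eq (measurableSet_cell R y) hvol V hVint hV1 a ha'
  rw [h, hvolR, ← mul_assoc, mul_comm ((R : ℝ) ^ 3), hRR, one_mul]

/-! ## §2 The oscillation bound per cell and the count of bad cells -/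

/-- The operator norm of a linear map on `ℝ³` is at most its Frobenius norm: `‖L‖² ≤ Σᵢ ‖L eᵢ‖²`. [folklore] -/
theorem opNorm_sq_le_dens (L : EuclideanSpace ℝ (Fin 3) →L[ℝ] EuclideanSpace ℝ (Fin 4)) :
    ‖L‖ ^ 2 ≤ ∑ i : Fin 3, ‖L (EuclideanSpace.single i (1:ℝ))‖ ^ 2 := by
  have hF0 : 0 ≤ Real.sqrt (∑ i : Fin 3, ‖L (EuclideanSpace.single i (1:ℝ))‖ ^ 2) := Real.sqrt_nonneg _
  have hop : ‖L‖ ≤ Real.sqrt (∑ i : Fin 3, ‖L (EuclideanSpace.single i (1:ℝ))‖ ^ 2) := by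
    refine ContinuousLinearMap.opNorm_le_bound _ hF0 fun x => ?_
    -- `x = Σ xᵢ eᵢ`, `‖L x‖ ≤ Σ |xᵢ| ‖L eᵢ‖ ≤ ‖x‖ √(Σ ‖L eᵢ‖²)`
    have hx : x = ∑ i : Fin 3, x i • EuclideanSpace.single i (1:ℝ) := by
      have h := (EuclideanSpace.basisFun (Fin 3) ℝ).sum_repr x
      simp only [EuclideanSpace.basisFun_repr, EuclideanSpace.basisFun_apply] at h
      exact h.symm
    have h1 : ‖L x‖ ≤ ∑ i : Fin 3, |x i| * ‖L (EuclideanSpace.single i (1:ℝ))‖ := by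
      conv_lhs => rw [hx]
      rw [map_sum]
      refine (norm_sum_le _ _).trans (Finset.sum_le_sum fun i _ => ?_)
      rw [map_smul, norm_smul, Real.norm_eq_abs]
    have h2 : ∑ i : Fin 3, |x i| * ‖L (EuclideanSpace.single i (1:ℝ))‖ ≤
        Real.sqrt (∑ i : Fin 3, |x i| ^ 2) * Real.sqrt (∑ i : Fin 3, ‖L (EuclideanSpace.single i (1:ℝ))‖ ^ 2) := by
      have := Real.sum_mul_le_sqrt_mul_sqrt (Finset.univ : Finset (Fin 3)) (fun i => |x i|)
        (fun i => ‖L (EuclideanSpace.single i (1:ℝ))‖)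
      simpa using this
    have h3 : Real.sqrt (∑ i : Fin 3, |x i| ^ 2) = ‖x‖ := by
      rw [EuclideanSpace.norm_eq]
      simp only [Real.norm_eq_abs]
    calc ‖L x‖ ≤ _ := h1
      _ ≤ _ := h2
      _ = Real.sqrt (∑ i : Fin 3, ‖L (EuclideanSpace.single i (1:ℝ))‖ ^ 2) * ‖x‖ := by rw [h3, mul_comm]
  have h0 : 0 ≤ ∑ i : Fin 3, ‖L (EuclideanSpace.single i (1:ℝ))‖ ^ 2 := Finset.sum_nonneg fun i _ => sq_nonneg _
  calc ‖L‖ ^ 2 ≤ (Real.sqrt (∑ i : Fin 3, ‖L (EuclideanSpace.single i (1:ℝ))‖ ^ 2)) ^ 2 :=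
        pow_le_pow_left₀ (norm_nonneg _) hop 2
    _ = _ := Real.sq_sqrt h0

/-- ★★ THE OSCILLATION BOUND PER CELL.  With `C_P` the cell Poincaré–Wirtinger constant of ✓`exists_eLpNorm_sq_sub_smul_setIntegral_cell_le`:
for a cell on which `V ∈ W^{1,2}` with weak gradient `GV` and `‖V‖ = 1`, the cell average `a = R³•∫_{cell}V` satisfies
`ofReal (1 − ‖a‖²) ≤ C_P²·R·∫⁻_{cell}‖GV‖ₑ²`. [cite: HardtKinderlehrerLin1986, §2] -/
theorem osc_le_lintegral_cell : ∃ C : ℝ≥0, ∀ (R : ℕ), 0 < R → ∀ (y : Zd 3)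
    (V : EuclideanSpace ℝ (Fin 3) → EuclideanSpace ℝ (Fin 4))
    (GV : EuclideanSpace ℝ (Fin 3) → EuclideanSpace ℝ (Fin 3) →L[ℝ] EuclideanSpace ℝ (Fin 4)),
    MemSobolevDomain 1 2 (⟨{x : EuclideanSpace ℝ (Fin 3) |
        ∀ i, (y i : ℝ) / R < x i ∧ x i < ((y i : ℝ) + 1) / R}, isOpen_cell R y⟩ : TopologicalSpace.Opens _) volume V →
    HasWeakFDerivOn (⟨{x : EuclideanSpace ℝ (Fin 3) |
        ∀ i, (y i : ℝ) / R < x i ∧ x i < ((y i : ℝ) + 1) / R}, isOpen_cell R y⟩ : TopologicalSpace.Opens _) volume V GV →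
    (∀ x ∈ {x : EuclideanSpace ℝ (Fin 3) | ∀ i, (y i : ℝ) / R < x i ∧ x i < ((y i : ℝ) + 1) / R}, ‖V x‖ = 1) →
    ∀ (a : EuclideanSpace ℝ (Fin 4)),
    a = ((R : ℝ) ^ 3) • (∫ x in {x : EuclideanSpace ℝ (Fin 3) | ∀ i, (y i : ℝ) / R < x i ∧ x i < ((y i : ℝ) + 1) / R}, V x) →
    ENNReal.ofReal (1 - ‖a‖ ^ 2) ≤
      (C : ℝ≥0∞) ^ 2 * ENNReal.ofReal (R : ℝ) *
        ∫⁻ x in {x : EuclideanSpace ℝ (Fin 3) | ∀ i, (y i : ℝ) / R < x i ∧ x i < ((y i : ℝ) + 1) / R}, ‖GV x‖ₑ ^ 2 := by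
  obtain ⟨C, hC⟩ := exists_eLpNorm_sq_sub_smul_setIntegral_cell_le
  refine ⟨C, fun R hR y V GV hV hGV hV1 a ha => ?_⟩
  set S : Set (EuclideanSpace ℝ (Fin 3)) := {x | ∀ i, (y i : ℝ) / R < x i ∧ x i < ((y i : ℝ) + 1) / R} with hSdef
  have hR0 : (0 : ℝ) < R := by exact_mod_cast hR
  -- `V ∈ L²(cell)`, hence integrable on the (finite-measure) cell
  have hL2 : MemLp V 2 (volume.restrict S) := hV.1
  have hvol : volume S ≠ ∞ := by rw [hSdef, volume_cell hR y]; exact ENNReal.ofReal_ne_top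
  haveI : IsFiniteMeasure (volume.restrict S) := ⟨by rw [Measure.restrict_apply_univ]; exact hvol.lt_top⟩
  have hVint : IntegrableOn V S volume := hL2.integrable one_le_two
  -- the Hilbert identity and the cell Poincaré–Wirtinger inequality
  have hid := one_sub_norm_sq_eq_integral hR y V hVint hV1 a ha
  have hPW := hC R hR y V GV hV hGV
  rw [← ha] at hPW
  rw [eLpNorm_two_sq, eLpNorm_two_sq] at hPW
  -- convert the real identity to `ℝ≥0∞`
  have hmeas : AEStronglyMeasurable (fun x => V x - a) (volume.restrict S) := hL2.1.sub aestronglyMeasurable_const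
  have hreal : ∫ x in S, ‖V x - a‖ ^ 2 = (∫⁻ x in S, ‖V x - a‖ₑ ^ 2).toReal :=
    integral_norm_sq_eq_toReal_lintegral _ hmeas
  have hfin : ∫⁻ x in S, ‖V x - a‖ₑ ^ 2 < ∞ := by
    have := (hL2.sub (memLp_const a)).eLpNorm_lt_top
    rw [← eLpNorm_two_sq]
    exact ENNReal.pow_lt_top this
  calc ENNReal.ofReal (1 - ‖a‖ ^ 2) = ENNReal.ofReal ((R : ℝ) ^ 3 * ∫ x in S, ‖V x - a‖ ^ 2) := by rw [hid]
    _ = ENNReal.ofReal ((R : ℝ) ^ 3) * ∫⁻ x in S, ‖V x - a‖ₑ ^ 2 := by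
        rw [ENNReal.ofReal_mul (by positivity), hreal, ENNReal.ofReal_toReal hfin.ne]
    _ ≤ ENNReal.ofReal ((R : ℝ) ^ 3) * ((C : ℝ≥0∞) ^ 2 * ENNReal.ofReal (((R : ℝ)⁻¹) ^ 2) * ∫⁻ x in S, ‖GV x‖ₑ ^ 2) :=
        mul_le_mul_right hPW _
    _ = (C : ℝ≥0∞) ^ 2 * ENNReal.ofReal (R : ℝ) * ∫⁻ x in S, ‖GV x‖ₑ ^ 2 := by
        have hRR : (R : ℝ) ^ 3 * ((R : ℝ)⁻¹) ^ 2 = R := by field_simp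
        rw [← mul_assoc, ← mul_assoc, mul_comm (ENNReal.ofReal ((R : ℝ) ^ 3)), mul_assoc ((C : ℝ≥0∞) ^ 2),
          ← ENNReal.ofReal_mul (by positivity), hRR]

/-- ★★★ **BAD CELLS ARE FEW.**  Let `V` be weakly differentiable on the open unit cube `Q` with weak gradient `GV`, `‖V‖ = 1` on `Q`, `‖V‖` bounded
a.e. by `1` and `GV·v ∈ L²(Q)` for every `v`.  For every `R ≥ 1`, every finite set `Y` of sites whose open cells lie in `Q`, every cell-average map
`a` (`a y = R³•∫_{cell_y}V`) and every `κ > 0`:  `ofReal κ · #{y ∈ Y | ‖a y‖² < 1 − κ} ≤ C_P²·R·∫⁻_Q ‖GV‖ₑ²`. [cite: HardtKinderlehrerLin1986, §2] -/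
theorem card_bad_mul_le : ∃ C : ℝ≥0, ∀ (R : ℕ), 0 < R →
    ∀ (V : EuclideanSpace ℝ (Fin 3) → EuclideanSpace ℝ (Fin 4))
      (GV : EuclideanSpace ℝ (Fin 3) → EuclideanSpace ℝ (Fin 3) →L[ℝ] EuclideanSpace ℝ (Fin 4)),
    HasWeakFDerivOn (⟨{x : EuclideanSpace ℝ (Fin 3) | ∀ i : Fin 3, |x i| < 1},
      Summit.QuantumFields.YangMills.Theorems.PoincareLipschitzSamplingCells.isOpen_absCube 1⟩ : TopologicalSpace.Opens _) volume V GV →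
    (∀ x : EuclideanSpace ℝ (Fin 3), (∀ i : Fin 3, |x i| < 1) → ‖V x‖ = 1) →
    (∀ v, MemLp (fun x => GV x v) 2 (volume.restrict {x : EuclideanSpace ℝ (Fin 3) | ∀ i : Fin 3, |x i| < 1})) →
    ∀ (Y : Finset (Zd 3)),
    (∀ y ∈ Y, {x : EuclideanSpace ℝ (Fin 3) | ∀ i, (y i : ℝ) / R < x i ∧ x i < ((y i : ℝ) + 1) / R} ⊆
      {x : EuclideanSpace ℝ (Fin 3) | ∀ i : Fin 3, |x i| < 1}) →
    ∀ (a : Zd 3 → EuclideanSpace ℝ (Fin 4)),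
    (∀ y, a y = ((R : ℝ) ^ 3) • ∫ x in {x : EuclideanSpace ℝ (Fin 3) |
        ∀ i, (y i : ℝ) / R < x i ∧ x i < ((y i : ℝ) + 1) / R}, V x) →
    ∀ (κ : ℝ), 0 < κ →
    ENNReal.ofReal κ * ((Y.filter fun y => ‖a y‖ ^ 2 < 1 - κ).card : ℝ≥0∞) ≤
      (C : ℝ≥0∞) ^ 2 * ENNReal.ofReal (R : ℝ) *
        ∫⁻ x in {x : EuclideanSpace ℝ (Fin 3) | ∀ i : Fin 3, |x i| < 1}, ‖GV x‖ₑ ^ 2 := by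
  classical
  obtain ⟨C, hC⟩ := osc_le_lintegral_cell
  refine ⟨C, fun R hR V GV hGV hV1 hGV2 Y hY a ha κ hκ => ?_⟩
  set Q : Set (EuclideanSpace ℝ (Fin 3)) := {x | ∀ i : Fin 3, |x i| < 1} with hQdef
  set B : Finset (Zd 3) := Y.filter fun y => ‖a y‖ ^ 2 < 1 - κ with hBdef
  -- cell opens are sub-opens of `Q`: restrict the weak derivative and the Sobolev membership
  have hcellQ : ∀ y ∈ Y, (⟨{x : EuclideanSpace ℝ (Fin 3) | ∀ i, (y i : ℝ) / R < x i ∧ x i < ((y i : ℝ) + 1) / R}, isOpen_cell R y⟩ :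
      TopologicalSpace.Opens _) ≤ ⟨Q, Summit.QuantumFields.YangMills.Theorems.PoincareLipschitzSamplingCells.isOpen_absCube 1⟩ :=
    fun y hy => hY y hy
  have hVbdd : ∀ᵐ x ∂(volume.restrict Q), ‖V x‖ ≤ (1 : ℝ) := by
    refine (ae_restrict_iff' (Summit.QuantumFields.YangMills.Theorems.PoincareLipschitzSamplingCells.isOpen_absCube 1).measurableSet).mpr
      (Filter.Eventually.of_forall fun x hx => (hV1 x hx).le)
  -- per bad cell: `κ ≤ 1 − ‖a y‖²`, and the oscillation bound
  have hper : ∀ y ∈ B, ENNReal.ofReal κ ≤ (C : ℝ≥0∞) ^ 2 * ENNReal.ofReal (R : ℝ) *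
      ∫⁻ x in {x : EuclideanSpace ℝ (Fin 3) | ∀ i, (y i : ℝ) / R < x i ∧ x i < ((y i : ℝ) + 1) / R}, ‖GV x‖ₑ ^ 2 := by
    intro y hy
    rw [hBdef, Finset.mem_filter] at hy
    obtain ⟨hyY, hbad⟩ := hy
    have hle := hcellQ y hyY
    have hGVy := Summit.QuantumFields.YangMills.Theorems.PoincareLipschitzSobolevCellAverages.hasWeakFDerivOn_mono hGV hle
    have hvolfin : volume ({x : EuclideanSpace ℝ (Fin 3) | ∀ i, (y i : ℝ) / R < x i ∧ x i < ((y i : ℝ) + 1) / R}) ≠ ∞ := by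
      rw [volume_cell hR y]; exact ENNReal.ofReal_ne_top
    have hVy := Summit.QuantumFields.YangMills.Theorems.PoincareLipschitzSobolevCellAverages.memSobolevDomain_one_two_of_bound
      hGV hle hvolfin hVbdd hGV2
    have h := hC R hR y V GV hVy hGVy (fun x hx => hV1 x (hY y hyY hx)) (a y) (ha y)
    exact (ENNReal.ofReal_le_ofReal (by linarith : κ ≤ 1 - ‖a y‖ ^ 2)).trans h
  -- sum over the bad cells: disjoint cells inside `Q`
  calc ENNReal.ofReal κ * (B.card : ℝ≥0∞) = ∑ y ∈ B, ENNReal.ofReal κ := by rw [Finset.sum_const, nsmul_eq_mul, mul_comm]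
    _ ≤ ∑ y ∈ B, (C : ℝ≥0∞) ^ 2 * ENNReal.ofReal (R : ℝ) *
        ∫⁻ x in {x : EuclideanSpace ℝ (Fin 3) | ∀ i, (y i : ℝ) / R < x i ∧ x i < ((y i : ℝ) + 1) / R}, ‖GV x‖ₑ ^ 2 :=
        Finset.sum_le_sum hper
    _ = (C : ℝ≥0∞) ^ 2 * ENNReal.ofReal (R : ℝ) *
        ∑ y ∈ B, ∫⁻ x in {x : EuclideanSpace ℝ (Fin 3) | ∀ i, (y i : ℝ) / R < x i ∧ x i < ((y i : ℝ) + 1) / R}, ‖GV x‖ₑ ^ 2 := by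
        rw [Finset.mul_sum]
    _ = (C : ℝ≥0∞) ^ 2 * ENNReal.ofReal (R : ℝ) *
        ∫⁻ x in ⋃ y ∈ B, {x : EuclideanSpace ℝ (Fin 3) | ∀ i, (y i : ℝ) / R < x i ∧ x i < ((y i : ℝ) + 1) / R}, ‖GV x‖ₑ ^ 2 := by
        rw [lintegral_biUnion_finset (fun y _ y' _ hne => disjoint_cell hR hne) (fun y _ => measurableSet_cell R y)]
    _ ≤ (C : ℝ≥0∞) ^ 2 * ENNReal.ofReal (R : ℝ) * ∫⁻ x in Q, ‖GV x‖ₑ ^ 2 := by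
        refine mul_le_mul_right (lintegral_mono_set ?_) _
        intro x hx
        simp only [Set.mem_iUnion] at hx
        obtain ⟨y, hy, hxy⟩ := hx
        exact hY y (Finset.mem_of_mem_filter y hy) hxy

/-! ## §3 The `‖GV‖ₑ` currency: `∫⁻_Q ‖GV‖ₑ² < ∞` from `GV·v ∈ L²(Q)` -/

/-- `‖L‖ₑ² ≤ Σᵢ ‖L eᵢ‖ₑ²` (the `ℝ≥0∞` form of `opNorm_sq_le_dens`). [folklore] -/
theorem enorm_sq_le_dens (L : EuclideanSpace ℝ (Fin 3) →L[ℝ] EuclideanSpace ℝ (Fin 4)) :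
    ‖L‖ₑ ^ 2 ≤ ∑ i : Fin 3, ‖L (EuclideanSpace.single i (1:ℝ))‖ₑ ^ 2 := by
  have h := opNorm_sq_le_dens L
  have hl : ‖L‖ₑ ^ 2 = ENNReal.ofReal (‖L‖ ^ 2) := by rw [← ofReal_norm, ENNReal.ofReal_pow (norm_nonneg _)]
  have hr : ∑ i : Fin 3, ‖L (EuclideanSpace.single i (1:ℝ))‖ₑ ^ 2 =
      ENNReal.ofReal (∑ i : Fin 3, ‖L (EuclideanSpace.single i (1:ℝ))‖ ^ 2) := by
    rw [ENNReal.ofReal_sum_of_nonneg (fun i _ => sq_nonneg _)]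
    exact Finset.sum_congr rfl fun i _ => by rw [← ofReal_norm, ENNReal.ofReal_pow (norm_nonneg _)]
  rw [hl, hr]
  exact ENNReal.ofReal_le_ofReal h

/-- `∫⁻_Q ‖GV‖ₑ² < ∞` when every `GV·v ∈ L²(Q)`. [folklore] -/
theorem lintegral_opNorm_sq_lt_top {Q : Set (EuclideanSpace ℝ (Fin 3))}
    (GV : EuclideanSpace ℝ (Fin 3) → EuclideanSpace ℝ (Fin 3) →L[ℝ] EuclideanSpace ℝ (Fin 4))
    (hGV2 : ∀ v, MemLp (fun x => GV x v) 2 (volume.restrict Q)) :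
    ∫⁻ x in Q, ‖GV x‖ₑ ^ 2 < ∞ := by
  have hmeas : ∀ i : Fin 3, AEMeasurable (fun x => ‖GV x (EuclideanSpace.single i (1:ℝ))‖ₑ ^ 2) (volume.restrict Q) :=
    fun i => ((hGV2 _).1.enorm.pow_const 2)
  calc ∫⁻ x in Q, ‖GV x‖ₑ ^ 2 ≤ ∫⁻ x in Q, ∑ i : Fin 3, ‖GV x (EuclideanSpace.single i (1:ℝ))‖ₑ ^ 2 :=
        lintegral_mono fun x => enorm_sq_le_dens (GV x)
    _ = ∑ i : Fin 3, ∫⁻ x in Q, ‖GV x (EuclideanSpace.single i (1:ℝ))‖ₑ ^ 2 := lintegral_finsetSum' _ fun i _ => hmeas i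
    _ < ∞ := by
        refine ENNReal.sum_lt_top.mpr fun i _ => ?_
        rw [← eLpNorm_two_sq]
        exact ENNReal.pow_lt_top (hGV2 _).eLpNorm_lt_top

end Summit.QuantumFields.YangMills.Theorems.PoincareLipschitzSobolevBadCellCount

end
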